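import Summits.CriticalPhenomena.Ising3DConformalLimit.Theorems.ExistsScaleCovariantLimit.Negative.DyadicIdentity
import Summits.CriticalPhenomena.Ising3DConformalLimit.Theorems.HyperoctahedralRPExistsScaleCovariantLimitDyadicLimitContinuous
import HarnessLib

/-!
# Pointwise boundedness + integer-configuration convergence ⟹ uniqueness of the cluster points of
the pinned zoom along subsequences of `b^{-k}`
(line `Sketch` of the crux `ExistsScaleCovariantLimit`, item stmt-CriticalPhenomena-1981;
stub `stub_uniqueOfIntConvergence`, glue G; any base `b ≥ 2`)

Write `F_n(δ)(x) = rescaledCorrelator (criticalCorr 3) rhoPin n δ x` for the pinned zoom of the critical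
`ℤ³` Ising correlators (`ρ_pin(δ) = ⟨σ₀σ_{⌊1/δ⌋e₀}⟩^{-1/2}`, so `F₂(δ)(0,e₀) = 1`). Assume

* (B) POINTWISE BOUNDEDNESS: at every non-coincident configuration `x`, `|F_n(δ)(x)| ≤ M_x` for all
  small `δ > 0`;
* (I) INTEGER CONVERGENCE: for every non-coincident configuration `y` with INTEGER coordinates the
  sequence `k ↦ F_n(b^{-k})(y)` converges.

Then any two locally uniform limits `S n`, `S' n` of the pinned zoom along subsequences `b^{-φ j}`,
`b^{-ψ j}` of the geometric meshes agree on `NonCoincident 3 n`. Proof: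

* `pairLimit_pos_of_bounded`: the limit of `F₂(b^{-j})(0, b^a e₀)` is POSITIVE — by the exact
  re-pinning identity (`pz_scale`, `n = 2`, `s = b^a`) and the exact pinning `F₂(δ)(0,e₀) = 1`,
  `F₂(b^{-(j+a)})(0, b^{-a}e₀) = (F₂(b^{-j})(0, b^a e₀))⁻¹`, and the left side is eventually bounded
  by (B) at the non-coincident pair `(0, b^{-a}e₀)`;
* `tendsto_geomMesh_bAdic_of_intConvergence`: at a `b`-adic rational configuration `x = b^{-a} y`
  (`y` integer) the WHOLE sequence `k ↦ F_n(b^{-k})(x)` converges: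
  `F_n(b^{-(j+a)})(x) = F₂(b^{-j})(0, b^a e₀)^{-n/2} · F_n(b^{-j})(y)` (`pz_scale`), both factors
  converge by (I), the first to a positive number;
* so `S n = S' n` at every `b`-adic rational non-coincident configuration; both are continuous on the
  open set `NonCoincident 3 n` (`continuousOn_seqLimit`: continuity of every sequential limit is
  automatic) and `b`-adic rationals are dense there (`bAdicApprox_tendsto_nhdsWithin`).

Adapted from `MonotoneRGZoomGlue.clusterPoints_eq_of_bAdic` / `tendsto_geomMesh_bAdic` (p103222), with
their `UniformRegularity` / `ZoomMonotone` inputs replaced by (B) and (I). No named facts, no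
definitions. [folklore]
-/

noncomputable section

namespace Summit.CriticalPhenomena.Ising3DConformalLimit.Cruxes.ExistsScaleCovariantLimit.TwoHierarchies

open Literature.Probability.LatticeModels Filter Set
open scoped Topology
open Summit.CriticalPhenomena.Ising3DConformalLimit.MoebiusLimitExistsOnlyInteraction (rhoPin)
open Summit.CriticalPhenomena.Ising3DConformalLimit.ExistsScaleCovariantLimitNegative.Dyadic
  (pz_scale cfg0_mem smul_cfg01 pz_two_cfg0_pos)
open Summit.CriticalPhenomena.Ising3DConformalLimit.PinnedClusterPoints (cfg01_mem rescaled_pin_cfg01)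

/-! ### Geometric meshes and `b`-adic rational approximation inside the open set `NonCoincident` -/

/-- `b^{-k} → 0⁺` for `b ≥ 2`. [folklore] -/
theorem tendsto_geomMesh_nhdsGT {b : ℕ} (hb : 2 ≤ b) :
    Tendsto (fun k : ℕ => ((b : ℝ) ^ k)⁻¹) atTop (𝓝[>] (0:ℝ)) := by
  -- adapted from Theorems/MonotoneRGZoomGlue.lean (p103222), `geomMesh_mem_and_tendsto`
  have hb1 : (1 : ℝ) < b := by exact_mod_cast (show 1 < b by omega)
  refine tendsto_nhdsWithin_iff.2 ⟨?_, Eventually.of_forall fun k => Set.mem_Ioi.2 (by positivity)⟩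
  exact tendsto_inv_atTop_zero.comp (tendsto_pow_atTop_atTop_of_one_lt hb1)

/-- The `b`-adic rational approximants `x⁽ᵐ⁾ᵢ = b^{-m}·[b^m xᵢ]` of a non-coincident configuration
`x` converge to it WITHIN the open set `NonCoincident 3 n`. [folklore] -/
theorem bAdicApprox_tendsto_nhdsWithin {b : ℕ} (hb : 2 ≤ b) {n : ℕ} {x : Fin n → EuclideanSpace ℝ (Fin 3)}
    (hx : x ∈ NonCoincident 3 n) :
    Tendsto (fun m : ℕ => fun i => ((b : ℝ) ^ m)⁻¹ • siteVec (latticeApprox (((b : ℝ) ^ m)⁻¹) (x i)))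
      atTop (𝓝[NonCoincident 3 n] x) := by
  -- adapted from Theorems/MonotoneRGZoomGlue.lean (p103222), `tendsto_bAdicApprox` (convergence in `𝓝 x`)
  have ht : Tendsto (fun m : ℕ => fun i => ((b : ℝ) ^ m)⁻¹ • siteVec (latticeApprox (((b : ℝ) ^ m)⁻¹) (x i)))
      atTop (𝓝 x) := by
    rw [tendsto_pi_nhds]
    intro i
    rw [tendsto_iff_norm_sub_tendsto_zero]
    have hb1 : (1 : ℝ) < b := by exact_mod_cast (show 1 < b by omega)
    have hδ : Tendsto (fun m : ℕ => ((b : ℝ) ^ m)⁻¹) atTop (𝓝 0) :=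
      tendsto_inv_atTop_zero.comp (tendsto_pow_atTop_atTop_of_one_lt hb1)
    have h2δ : Tendsto (fun m : ℕ => 2 * ((b : ℝ) ^ m)⁻¹) atTop (𝓝 0) := by
      simpa using hδ.const_mul (2:ℝ)
    refine squeeze_zero (fun m => norm_nonneg _) (fun m => ?_) h2δ
    have hpos : (0 : ℝ) < ((b : ℝ) ^ m)⁻¹ := by positivity
    -- coordinatewise floor error `≤ δ`, Euclidean norm `≤ √3 δ ≤ 2δ`
    have hcoord : ∀ j, |(((b : ℝ) ^ m)⁻¹ • siteVec (latticeApprox (((b : ℝ) ^ m)⁻¹) (x i)) - x i) j| ≤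
        ((b : ℝ) ^ m)⁻¹ := by
      intro j
      rw [PiLp.sub_apply, PiLp.smul_apply, siteVec_apply, smul_eq_mul]
      exact abs_mul_latticeApprox_sub_le hpos (x i) j
    rw [EuclideanSpace.norm_eq]
    have hsum : ∑ j, ‖(((b : ℝ) ^ m)⁻¹ • siteVec (latticeApprox (((b : ℝ) ^ m)⁻¹) (x i)) - x i) j‖ ^ 2 ≤
        (2 * ((b : ℝ) ^ m)⁻¹) ^ 2 := by
      calc ∑ j, ‖(((b : ℝ) ^ m)⁻¹ • siteVec (latticeApprox (((b : ℝ) ^ m)⁻¹) (x i)) - x i) j‖ ^ 2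
          ≤ ∑ _j : Fin 3, (((b : ℝ) ^ m)⁻¹) ^ 2 := Finset.sum_le_sum fun j _ => by
              rw [Real.norm_eq_abs]
              exact pow_le_pow_left₀ (abs_nonneg _) (hcoord j) 2
        _ = 3 * (((b : ℝ) ^ m)⁻¹) ^ 2 := by simp
        _ ≤ (2 * ((b : ℝ) ^ m)⁻¹) ^ 2 := by nlinarith [sq_nonneg (((b : ℝ) ^ m)⁻¹)]
    calc Real.sqrt (∑ j, ‖(((b : ℝ) ^ m)⁻¹ • siteVec (latticeApprox (((b : ℝ) ^ m)⁻¹) (x i)) - x i) j‖ ^ 2)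
        ≤ Real.sqrt ((2 * ((b : ℝ) ^ m)⁻¹) ^ 2) := Real.sqrt_le_sqrt hsum
      _ = 2 * ((b : ℝ) ^ m)⁻¹ := Real.sqrt_sq (by positivity)
  exact tendsto_nhdsWithin_iff.2 ⟨ht, ht.eventually ((isOpen_nonCoincident 3 n).mem_nhds hx)⟩

/-! ### Axis pairs: integer coordinates, dilation, and positivity of the pair limit from (B) -/

/-- The axis pair `(0, b^a e₀)` has integer coordinates. [folklore] -/
theorem cfg0_pow_intCoord (b a : ℕ) :
    ∀ i j, ∃ z : ℤ,
      (![0, EuclideanSpace.single 0 ((b : ℝ) ^ a)] : Fin 2 → EuclideanSpace ℝ (Fin 3)) i j = (z : ℝ) := by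
  -- adapted from Theorems/MonotoneRGZoomGluePointwise.lean (p103222), `cfg0_natCast_int`
  intro i j
  fin_cases i
  · exact ⟨0, by simp⟩
  · by_cases hj : j = 0
    · subst hj
      exact ⟨(b : ℤ) ^ a, by simp⟩
    · exact ⟨0, by simp [hj]⟩

/-- **Inversion identity of the pinned pair zoom**:
`F₂(b^{-(j+a)})(0, b^{-a}e₀) = (F₂(b^{-j})(0, b^a e₀))⁻¹` — the exact re-pinning identity `pz_scale` with
`n = 2`, `s = b^a`, `δ = b^{-j}`, together with the exact pinning `F₂(δ)(0, e₀) = 1`. [folklore] -/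
theorem pz_two_cfg0_inv {b : ℕ} (hb : 2 ≤ b) (a j : ℕ) :
    rescaledCorrelator (criticalCorr 3) rhoPin 2 (((b : ℝ) ^ (j + a))⁻¹)
        (![0, EuclideanSpace.single 0 (((b : ℝ) ^ a)⁻¹)] : Fin 2 → EuclideanSpace ℝ (Fin 3)) =
      (rescaledCorrelator (criticalCorr 3) rhoPin 2 (((b : ℝ) ^ j)⁻¹)
        (![0, EuclideanSpace.single 0 ((b : ℝ) ^ a)] : Fin 2 → EuclideanSpace ℝ (Fin 3)))⁻¹ := by
  have hb0 : (0 : ℝ) < b := by exact_mod_cast (show 0 < b by omega)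
  have hs : (0 : ℝ) < (b : ℝ) ^ a := pow_pos hb0 a
  have h := pz_scale (s := (b : ℝ) ^ a) hs (by positivity : (0:ℝ) < ((b : ℝ) ^ j)⁻¹) 2
    (![0, EuclideanSpace.single 0 (((b : ℝ) ^ a)⁻¹)] : Fin 2 → EuclideanSpace ℝ (Fin 3))
  have e : ((b : ℝ) ^ a)⁻¹ * ((b : ℝ) ^ j)⁻¹ = ((b : ℝ) ^ (j + a))⁻¹ := by
    rw [pow_add, mul_inv, mul_comm]
  -- dilating the pair `(0, b^{-a} e₀)` by `b^a` gives the reference pair `(0, e₀)`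
  have hdil : (fun i => ((b : ℝ) ^ a) •
      (![0, EuclideanSpace.single 0 (((b : ℝ) ^ a)⁻¹)] : Fin 2 → EuclideanSpace ℝ (Fin 3)) i) =
      (![0, EuclideanSpace.single 0 1] : Fin 2 → EuclideanSpace ℝ (Fin 3)) := by
    rw [← smul_cfg01 (((b : ℝ) ^ a)⁻¹)]
    funext i
    simp only [smul_inv_smul₀ hs.ne']
  have hexp : (-((2:ℕ):ℝ) / 2) = -1 := by norm_num
  rw [e, hdil, rescaled_pin_cfg01, mul_one, hexp, Real.rpow_neg_one] at h
  exact h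

/-- **Positivity of the pair limit from pointwise boundedness (B).** If `F₂(b^{-j})(0, b^a e₀) → L`
then `0 < L`: by `pz_two_cfg0_inv` its inverse is `F₂(b^{-(j+a)})(0, b^{-a}e₀)`, which (B) at the
non-coincident pair `(0, b^{-a}e₀)`, transported along `j ↦ b^{-(j+a)} → 0⁺`, bounds by some `M`
eventually; so `F₂(b^{-j})(0, b^a e₀) ≥ (max M 1)⁻¹ > 0` eventually (`pz_two_cfg0_pos`), and
`L ≥ (max M 1)⁻¹` (`ge_of_tendsto`). [folklore] -/
theorem pairLimit_pos_of_bounded {b : ℕ} (hb : 2 ≤ b)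
    (hB : ∀ n : ℕ, ∀ x ∈ NonCoincident 3 n, ∃ M : ℝ,
      ∀ᶠ δ in 𝓝[>] (0:ℝ), |rescaledCorrelator (criticalCorr 3) rhoPin n δ x| ≤ M)
    (a : ℕ) {L : ℝ}
    (hL : Tendsto (fun j : ℕ => rescaledCorrelator (criticalCorr 3) rhoPin 2 (((b : ℝ) ^ j)⁻¹)
      (![0, EuclideanSpace.single 0 ((b : ℝ) ^ a)] : Fin 2 → EuclideanSpace ℝ (Fin 3))) atTop (𝓝 L)) :
    0 < L := by
  have hb0 : (0 : ℝ) < b := by exact_mod_cast (show 0 < b by omega)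
  have hs : (0 : ℝ) < (b : ℝ) ^ a := pow_pos hb0 a
  -- (B) at the non-coincident pair `(0, b^{-a} e₀)`, transported along `j ↦ b^{-(j+a)} → 0⁺`
  obtain ⟨M, hM⟩ := hB 2 _ (cfg0_mem (inv_ne_zero hs.ne'))
  have hu : Tendsto (fun j : ℕ => ((b : ℝ) ^ (j + a))⁻¹) atTop (𝓝[>] (0:ℝ)) :=
    (tendsto_geomMesh_nhdsGT hb).comp (tendsto_add_atTop_nat a)
  have hev : ∀ᶠ j : ℕ in atTop, |rescaledCorrelator (criticalCorr 3) rhoPin 2 (((b : ℝ) ^ (j + a))⁻¹)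
      (![0, EuclideanSpace.single 0 (((b : ℝ) ^ a)⁻¹)] : Fin 2 → EuclideanSpace ℝ (Fin 3))| ≤ M :=
    hu.eventually hM
  -- hence `F₂(b^{-j})(0, b^a e₀) ≥ (max M 1)⁻¹` eventually
  have hK : 0 < max M 1 := lt_of_lt_of_le one_pos (le_max_right M 1)
  have hlow : ∀ᶠ j : ℕ in atTop, (max M 1)⁻¹ ≤ rescaledCorrelator (criticalCorr 3) rhoPin 2
      (((b : ℝ) ^ j)⁻¹) (![0, EuclideanSpace.single 0 ((b : ℝ) ^ a)] : Fin 2 → EuclideanSpace ℝ (Fin 3)) := by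
    filter_upwards [hev] with j hj
    have hP := pz_two_cfg0_pos (((b : ℝ) ^ j)⁻¹) ((b : ℝ) ^ a)
    refine inv_le_of_inv_le₀ hP ?_
    rw [← pz_two_cfg0_inv hb a j]
    exact (le_abs_self _).trans (hj.trans (le_max_left M 1))
  exact lt_of_lt_of_le (inv_pos.2 hK) (ge_of_tendsto hL hlow)

/-! ### Convergence of the whole geometric sequence at `b`-adic rational configurations -/

/-- **`b`-adic rational configurations: the pinned zoom converges along the geometric meshes `b^{-k}`**
(from (B) and (I)). For `x = (b^a)⁻¹ • y` with `y` an integer configuration and `x` non-coincident: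
`F_n(b^{-(j+a)})(x) = F₂(b^{-j})(0, b^a e₀)^{-n/2} · F_n(b^{-j})(y)` (`pz_scale`); both factors converge
by (I) (at the integer configurations `y` and `(0, b^a e₀)`), the first to a positive number
(`pairLimit_pos_of_bounded`), so the product converges; shift the index by `a`. [folklore] -/
theorem tendsto_geomMesh_bAdic_of_intConvergence {b : ℕ} (hb : 2 ≤ b)
    (hB : ∀ n : ℕ, ∀ x ∈ NonCoincident 3 n, ∃ M : ℝ,
      ∀ᶠ δ in 𝓝[>] (0:ℝ), |rescaledCorrelator (criticalCorr 3) rhoPin n δ x| ≤ M)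
    (hI : ∀ (n : ℕ) (y : Fin n → EuclideanSpace ℝ (Fin 3)), y ∈ NonCoincident 3 n →
      (∀ i j, ∃ z : ℤ, y i j = (z : ℝ)) →
      ∃ L : ℝ, Tendsto (fun k : ℕ => rescaledCorrelator (criticalCorr 3) rhoPin n (((b:ℝ) ^ k)⁻¹) y)
        atTop (𝓝 L))
    (a : ℕ) {n : ℕ} {y : Fin n → EuclideanSpace ℝ (Fin 3)} (hint : ∀ i j, ∃ z : ℤ, y i j = (z : ℝ))
    (hx : (fun i => ((b : ℝ) ^ a)⁻¹ • y i) ∈ NonCoincident 3 n) :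
    ∃ L : ℝ, Tendsto (fun k : ℕ => rescaledCorrelator (criticalCorr 3) rhoPin n (((b : ℝ) ^ k)⁻¹)
      (fun i => ((b : ℝ) ^ a)⁻¹ • y i)) atTop (𝓝 L) := by
  -- adapted from Theorems/MonotoneRGZoomGluePointwise.lean (p103222), `tendsto_geomMesh_bAdic`
  have hb0 : (0 : ℝ) < b := by exact_mod_cast (show 0 < b by omega)
  have hs : (0 : ℝ) < (b : ℝ) ^ a := pow_pos hb0 a
  -- `y` itself is non-coincident (it is the dilate of `x` by `b^a`)
  have hyx : (fun i => ((b : ℝ) ^ a) • ((((b : ℝ) ^ a)⁻¹ • y i))) = y :=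
    funext fun i => smul_inv_smul₀ hs.ne' (y i)
  have hy : y ∈ NonCoincident 3 n := by
    have h := smul_mem_nonCoincident hs.ne' hx
    rwa [hyx] at h
  -- the two integer-configuration limits, the pair limit being positive
  obtain ⟨L₁, hL₁⟩ := hI n y hy hint
  have hcfg : (![0, EuclideanSpace.single 0 ((b : ℝ) ^ a)] : Fin 2 → EuclideanSpace ℝ (Fin 3)) ∈
      NonCoincident 3 2 := cfg0_mem hs.ne'
  obtain ⟨L₂, hL₂⟩ := hI 2 _ hcfg (cfg0_pow_intCoord b a)
  have hL₂pos : 0 < L₂ := pairLimit_pos_of_bounded hb hB a hL₂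
  -- the product converges
  have hprod : Tendsto (fun j : ℕ =>
      (rescaledCorrelator (criticalCorr 3) rhoPin 2 (((b : ℝ) ^ j)⁻¹)
        (![0, EuclideanSpace.single 0 ((b : ℝ) ^ a)] : Fin 2 → EuclideanSpace ℝ (Fin 3))) ^ (-(n:ℝ) / 2) *
      rescaledCorrelator (criticalCorr 3) rhoPin n (((b : ℝ) ^ j)⁻¹) y) atTop
      (𝓝 (L₂ ^ (-(n:ℝ) / 2) * L₁)) :=
    (hL₂.rpow_const (Or.inl hL₂pos.ne')).mul hL₁
  -- the exact re-pinning identity at the shifted index `j + a`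
  have hid : ∀ j : ℕ, rescaledCorrelator (criticalCorr 3) rhoPin n (((b : ℝ) ^ (j + a))⁻¹)
      (fun i => ((b : ℝ) ^ a)⁻¹ • y i) =
      (rescaledCorrelator (criticalCorr 3) rhoPin 2 (((b : ℝ) ^ j)⁻¹)
        (![0, EuclideanSpace.single 0 ((b : ℝ) ^ a)] : Fin 2 → EuclideanSpace ℝ (Fin 3))) ^ (-(n:ℝ) / 2) *
      rescaledCorrelator (criticalCorr 3) rhoPin n (((b : ℝ) ^ j)⁻¹) y := by
    intro j
    have h := pz_scale (s := (b : ℝ) ^ a) hs (by positivity : (0:ℝ) < ((b : ℝ) ^ j)⁻¹) n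
      (fun i => ((b : ℝ) ^ a)⁻¹ • y i)
    have e : ((b : ℝ) ^ a)⁻¹ * ((b : ℝ) ^ j)⁻¹ = ((b : ℝ) ^ (j + a))⁻¹ := by
      rw [pow_add, mul_inv, mul_comm]
    rw [e, hyx] at h
    exact h
  refine ⟨L₂ ^ (-(n:ℝ) / 2) * L₁, (tendsto_add_atTop_iff_nat a).1 ?_⟩
  exact hprod.congr fun j => (hid j).symm

/-! ### The stub: uniqueness of cluster points along subsequences of `b^{-k}` -/

/-- **G — glue: pointwise boundedness (B) + integer-configuration convergence along `b^k` (I) ⟹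
uniqueness of locally-uniform cluster points of the pinned zoom along subsequences of `b^{-k}`** (any
base `b ≥ 2`). Both cluster points are continuous on the open set `NonCoincident 3 n`
(`continuousOn_seqLimit`, automatic for every sequential limit); at a `b`-adic rational configuration
`x = b^{-a} y` (`y` integer) the whole sequence `k ↦ F_n(b^{-k})(x)` converges
(`tendsto_geomMesh_bAdic_of_intConvergence`), so both cluster points take the value of that limit
there; and the `b`-adic rational configurations `b^{-m}[b^m x]` approximate `x` inside `NonCoincident`
(`bAdicApprox_tendsto_nhdsWithin`, `isOpen_nonCoincident`). [folklore] -/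
theorem stub_uniqueOfIntConvergence :
    ∀ b : ℕ, 2 ≤ b →
    (∀ n : ℕ, ∀ x ∈ NonCoincident 3 n, ∃ M : ℝ,
      ∀ᶠ δ in 𝓝[>] (0:ℝ), |rescaledCorrelator (criticalCorr 3) rhoPin n δ x| ≤ M) →
    (∀ (n : ℕ) (y : Fin n → EuclideanSpace ℝ (Fin 3)), y ∈ NonCoincident 3 n →
      (∀ i j, ∃ z : ℤ, y i j = (z : ℝ)) →
      ∃ L : ℝ, Tendsto (fun k : ℕ => rescaledCorrelator (criticalCorr 3) rhoPin n (((b:ℝ) ^ k)⁻¹) y)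
        atTop (𝓝 L)) →
    ∀ (φ ψ : ℕ → ℕ) (S S' : CorrFamily 3), StrictMono φ → StrictMono ψ →
      (∀ n : ℕ, TendstoLocallyUniformlyOn
        (fun j : ℕ => rescaledCorrelator (criticalCorr 3) rhoPin n (((b:ℝ) ^ (φ j))⁻¹)) (S n) atTop
        (NonCoincident 3 n)) →
      (∀ n : ℕ, TendstoLocallyUniformlyOn
        (fun j : ℕ => rescaledCorrelator (criticalCorr 3) rhoPin n (((b:ℝ) ^ (ψ j))⁻¹)) (S' n) atTop
        (NonCoincident 3 n)) →
      ∀ n : ℕ, ∀ x ∈ NonCoincident 3 n, S n x = S' n x := by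
  intro b hb hB hI φ ψ S S' hφ hψ hS hS' n x hx
  -- (0) continuity of both cluster points on `NonCoincident 3 n` is automatic
  have hu := tendsto_geomMesh_nhdsGT hb
  have hc : ContinuousOn (S n) (NonCoincident 3 n) :=
    continuousOn_seqLimit (u := fun j => ((b : ℝ) ^ (φ j))⁻¹) (hu.comp hφ.tendsto_atTop) (hS n)
  have hc' : ContinuousOn (S' n) (NonCoincident 3 n) :=
    continuousOn_seqLimit (u := fun j => ((b : ℝ) ^ (ψ j))⁻¹) (hu.comp hψ.tendsto_atTop) (hS' n)
  -- adapted from Theorems/MonotoneRGZoomGlue.lean (p103222), `clusterPoints_eq_of_bAdic`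
  -- (1) agreement at every `b`-adic rational non-coincident configuration
  have hagree : ∀ (a : ℕ) (y : Fin n → EuclideanSpace ℝ (Fin 3)), (∀ i j, ∃ z : ℤ, y i j = (z : ℝ)) →
      (fun i => ((b : ℝ) ^ a)⁻¹ • y i) ∈ NonCoincident 3 n →
      S n (fun i => ((b : ℝ) ^ a)⁻¹ • y i) = S' n (fun i => ((b : ℝ) ^ a)⁻¹ • y i) := by
    intro a y hint hz
    obtain ⟨L, hL⟩ := tendsto_geomMesh_bAdic_of_intConvergence hb hB hI a hint hz
    have e1 : S n (fun i => ((b : ℝ) ^ a)⁻¹ • y i) = L :=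
      tendsto_nhds_unique ((hS n).tendsto_at hz) (hL.comp hφ.tendsto_atTop)
    have e2 : S' n (fun i => ((b : ℝ) ^ a)⁻¹ • y i) = L :=
      tendsto_nhds_unique ((hS' n).tendsto_at hz) (hL.comp hψ.tendsto_atTop)
    rw [e1, e2]
  -- (2) approximate `x` by `b`-adic rationals inside the open set `NonCoincident 3 n`
  set xm : ℕ → (Fin n → EuclideanSpace ℝ (Fin 3)) :=
    fun m i => ((b : ℝ) ^ m)⁻¹ • siteVec (latticeApprox (((b : ℝ) ^ m)⁻¹) (x i))
  have hxm_w : Tendsto xm atTop (𝓝[NonCoincident 3 n] x) := bAdicApprox_tendsto_nhdsWithin hb hx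
  have hxm_mem : ∀ᶠ m in atTop, xm m ∈ NonCoincident 3 n := hxm_w.eventually_mem self_mem_nhdsWithin
  have hSx : Tendsto (fun m => S n (xm m)) atTop (𝓝 (S n x)) := (hc x hx).tendsto.comp hxm_w
  have hS'x : Tendsto (fun m => S' n (xm m)) atTop (𝓝 (S' n x)) := (hc' x hx).tendsto.comp hxm_w
  -- the approximants are `b`-adic rational: integer coordinates after dilation by `b^m`
  have hint : ∀ (m : ℕ) (i : Fin n) (j : Fin 3), ∃ z : ℤ,
      (fun i => siteVec (latticeApprox (((b : ℝ) ^ m)⁻¹) (x i))) i j = (z : ℝ) :=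
    fun m i j => ⟨latticeApprox (((b : ℝ) ^ m)⁻¹) (x i) j, by simp⟩
  have heq : ∀ᶠ m in atTop, S n (xm m) = S' n (xm m) :=
    hxm_mem.mono fun m hm => hagree m _ (hint m) hm
  exact tendsto_nhds_unique hSx (hS'x.congr' (heq.mono fun m hm => hm.symm))

end Summit.CriticalPhenomena.Ising3DConformalLimit.Cruxes.ExistsScaleCovariantLimit.TwoHierarchies

end
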